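import Summits.ValiantsHypothesis.ValiantsHypothesis.Theorems.KPlusLogSqLawTropicalOrbitRules
import Summits.ValiantsHypothesis.ValiantsHypothesis.Theorems.KPlusLogSqLawTropicalSymmetricThreeRowPairwise

/-!
# Tropical census, symmetric `3 × 3` designs — the PAIR-CARRIER orbit rules R3w / R3′w / R2w / R2′w in `m = 3` letter coordinates

HONEST FRAMING.  Helper file (seat typer (g11), cell `pub-symmetroid`, 2026-08-27; `--supports` the `WeakLifting` item
stmt-ValiantsHypothesis-19561 as a helper, no closure claim; desk word R1640 (3) «type them now in m = 3 letters»).  Pure lemma file;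
the orbit-carrier model of `…TropicalOrbitDominance` / `…TropicalOrbitExchange` / `…TropicalOrbitRules` at `m = 3`, arbitrary `K`,
integer slopes, no sweep, no strictness, no adjacency.  The four pairwise rules of the method memo
`HOME/theory/g23/method/TSYM34-METHOD-g23.md` §3 that involve the PAIR carrier `C(c)` (the 3-cycle orbit), each ONE application of an
exchange lemma with named hybrids:
* `rule_R3w`  (`D(λ)` at `θ₁`, `C(c)` at `θ₂`): `d(λ_i) + d(λ_j) < 2·d(c_{ij})`      — `orbit_exchange₂`, hybrids `T_{ij}(c_{ij}|λ_k)`,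
  `T_{jk}(c_{jk}|λ_i)`, `T_{ik}(c_{ik}|λ_j)`;
* `rule_R3w'` (`C(c)` at `θ₁`, `D(λ)` at `θ₂`): `2·d(c_{ij}) < d(λ_i) + d(λ_j)`      — `orbit_exchange₂'`, same hybrids;
* `rule_R2w`  (`T_{ij}(b|a)` at `θ₁`, `C(c)` at `θ₂`): `d a + d b < d(c_{jk}) + d(c_{ik})` — `orbit_exchange₂_le`, hybrids `C(c; c_{ij} ↦ b)`
  (twice, once weakly) and `T_{ij}(c_{ij}|a)`;
* `rule_R2w'` (`C(c)` at `θ₁`, `T_{ij}(b|a)` at `θ₂`): `d(c_{jk}) + d(c_{ik}) < d a + d b` — `orbit_exchange₂'_le`, same hybrids.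
COORDINATES.  `{i, j, k} = Fin 3` (pairwise distinct); the pair carrier is ANY permutation `σ` with `σ i = j`, `σ j = k`, `σ k = i`
(the 3-cycle `i → j → k → i`; the other 3-cycle is `σ⁻¹`, covered by relabelling `(i, k, j)` or by `isOrbitDominant_transpose`); the term
`(σ, ν)` carries the letter `ν i` on the pair `{i, j}` (cell `(j, i)`), `ν j` on `{j, k}` (cell `(k, j)`), `ν k` on `{i, k}` (cell `(i, k)`);
`D(λ) = (1, λ)`; `T_{ij}(b|a) = (swap i j, [i, j ↦ b; k ↦ a])`.  Valuations are SYMMETRIC (`hv`), which equates the heights of transposed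
cells in the bookkeeping; presence of the hybrids is assumed (as in `rule_R1w`) — it follows from the presence of the letters of the two
dominant orbits and is discharged by the user.  Nothing here is a census numeral: tropical objects bound no real pencil; ζ_sym(3,4) ∈ {18,19},
the kernel single-term `(3,4)` window `[15, 18]`, DoorA34 = `PosRootLawAt 3 4 18` (stmt-ValiantsHypothesis-19980) and DoorA26 (stmt-19979)
are untouched (OPEN, typed, never asserted); nothing on `TropicalB` / `WeakLifting` as closed, on `MatrixDescartes` (stmt-ValiantsHypothesis-18050)
or on `VP ≠ VNP`.  [folklore] (linear exchange arguments; method memo §3).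
-/

-- `Summit.ValiantsHypothesis.ValiantsHypothesis.…` is the tree's mandated single-conjunct layout (Sub = Summit).
set_option linter.dupNamespace false
set_option autoImplicit false

namespace Summit.ValiantsHypothesis.ValiantsHypothesis.Theorems.LacunarySymmetroidMatrixDescartes.TropicalCensus.Orbit

open Summit.ValiantsHypothesis.ValiantsHypothesis.Theorems.MatrixDescartes.Negative
open Summit.ValiantsHypothesis.ValiantsHypothesis.Theorems.LacunarySymmetroidMatrixDescartes
open Summit.ValiantsHypothesis.ValiantsHypothesis.Theorems.LacunarySymmetroidMatrixDescartes.TropicalCensus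
open scoped BigOperators

variable {K : ℕ}

/-! ## `Fin 3` bookkeeping and carrier facts -/

/-- a sum over `Fin 3` written at a labelling `{i, j, k} = Fin 3`. [folklore] -/
theorem sum_three {i j k : Fin 3} (hij : i ≠ j) (hki : k ≠ i) (hkj : k ≠ j) (F : Fin 3 → ℤ) :
    ∑ l, F l = F i + F j + F k := by
  rw [← Finset.add_sum_erase _ _ (Finset.mem_univ i),
    ← Finset.add_sum_erase _ _ (Finset.mem_erase.mpr ⟨hij.symm, Finset.mem_univ j⟩),
    univ_erase_erase_three i j k hij hki hkj, Finset.sum_singleton]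
  ring

/-- two permutations that differ at a point differ. -/
theorem perm_ne_of_apply_ne {σ τ : Equiv.Perm (Fin 3)} (x : Fin 3) (h : σ x ≠ τ x) : σ ≠ τ :=
  fun e => h (by rw [e])

/-- terms with different carriers differ. -/
theorem term_ne_of_fst_ne {p q : Equiv.Perm (Fin 3) × (Fin 3 → Fin K)} (h : p.1 ≠ q.1) : p ≠ q :=
  fun e => h (congrArg Prod.fst e)

/-- the carrier of the transposed term is the inverse carrier. -/
theorem transposeTerm_fst (p : Equiv.Perm (Fin 3) × (Fin 3 → Fin K)) : (transposeTerm p).1 = p.1⁻¹ := rfl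

section ThreeCycle

variable {i j k : Fin 3} (hij : i ≠ j) (hki : k ≠ i) (hkj : k ≠ j)
  (σ : Equiv.Perm (Fin 3)) (hσi : σ i = j) (hσj : σ j = k) (hσk : σ k = i)
include hij hki hkj hσi hσj hσk

omit hij hki hkj in
/-- values of the inverse 3-cycle. -/
theorem cycle_inv_apply : σ⁻¹ i = k ∧ σ⁻¹ j = i ∧ σ⁻¹ k = j :=
  ⟨Equiv.Perm.inv_eq_iff_eq.mpr hσk.symm, Equiv.Perm.inv_eq_iff_eq.mpr hσi.symm, Equiv.Perm.inv_eq_iff_eq.mpr hσj.symm⟩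

/-- the transposition `(i j)` is neither the 3-cycle nor its inverse, and is not the identity. -/
theorem swap_ij_ne_cycle : Equiv.swap i j ≠ σ ∧ Equiv.swap i j ≠ σ⁻¹ ∧ Equiv.swap i j ≠ 1 := by
  refine ⟨perm_ne_of_apply_ne j ?_, perm_ne_of_apply_ne i ?_, swap_ne_one_perm hij⟩
  · rw [Equiv.swap_apply_right, hσj]; exact hki.symm
  · rw [Equiv.swap_apply_left, (cycle_inv_apply σ hσi hσj hσk).1]; exact hkj.symm

omit hkj in
/-- the transposition `(j k)` is neither the 3-cycle nor its inverse. -/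
theorem swap_jk_ne_cycle : Equiv.swap j k ≠ σ ∧ Equiv.swap j k ≠ σ⁻¹ := by
  refine ⟨perm_ne_of_apply_ne k ?_, perm_ne_of_apply_ne j ?_⟩
  · rw [Equiv.swap_apply_right, hσk]; exact hij.symm
  · rw [Equiv.swap_apply_left, (cycle_inv_apply σ hσi hσj hσk).2.1]; exact hki

omit hki in
/-- the transposition `(i k)` is neither the 3-cycle nor its inverse. -/
theorem swap_ik_ne_cycle : Equiv.swap i k ≠ σ ∧ Equiv.swap i k ≠ σ⁻¹ := by
  refine ⟨perm_ne_of_apply_ne i ?_, perm_ne_of_apply_ne k ?_⟩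
  · rw [Equiv.swap_apply_left, hσi]; exact hkj
  · rw [Equiv.swap_apply_right, (cycle_inv_apply σ hσi hσj hσk).2.2]; exact hij

/-! ## Rule R3w / R3′w: the identity orbit against the pair orbit -/

/-- **Rule R3w** (`D(λ)` orbit-dominant at `θ₁`, `C(c) = (σ, ν)` orbit-dominant at `θ₂ > θ₁`; the three transposition hybrids
`T_{ij}(ν i|λ k)`, `T_{jk}(ν j|λ i)`, `T_{ik}(ν k|λ j)` present): `d(λ i) + d(λ j) < 2·d(ν i)` — the pair `{i,j}` read by `C` with letter
`ν i`.  (The other two pairs: relabel `(i,j,k) ↦ (j,k,i)`, `(k,i,j)` — the hypotheses are cyclic.) [folklore; method memo §3 R3w] -/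
theorem rule_R3w (d : Fin K → ℕ) (v ε : Fin 3 → Fin 3 → Fin K → ℤ) (hv : ∀ a b l, v a b l = v b a l)
    {θ₁ θ₂ : ℤ} (hθ : θ₁ < θ₂) (lam ν : Fin 3 → Fin K)
    (hD : IsOrbitDominant d v ε θ₁ (1, lam)) (hC : IsOrbitDominant d v ε θ₂ (σ, ν))
    (hH₁ : termSign ε (Equiv.swap i j, fun l => if l = i ∨ l = j then ν i else lam l) ≠ 0)
    (hH₂ : termSign ε (Equiv.swap j k, fun l => if l = j ∨ l = k then ν j else lam l) ≠ 0)
    (hH₃ : termSign ε (Equiv.swap i k, fun l => if l = i ∨ l = k then ν k else lam l) ≠ 0) :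
    (d (lam i) : ℤ) + d (lam j) < 2 * d (ν i) := by
  obtain ⟨n1, n1', n1''⟩ := swap_ij_ne_cycle hij hki hkj σ hσi hσj hσk
  obtain ⟨n2, n2'⟩ := swap_jk_ne_cycle hij hki σ hσi hσj hσk
  obtain ⟨n3, n3'⟩ := swap_ik_ne_cycle hij hkj σ hσi hσj hσk
  have hjk : j ≠ k := fun h => hkj h.symm
  have hik : i ≠ k := fun h => hki h.symm
  have h := orbit_exchange₂ d v ε hθ (1, lam) (σ, ν)
    (Equiv.swap i j, fun l => if l = i ∨ l = j then ν i else lam l)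
    (Equiv.swap j k, fun l => if l = j ∨ l = k then ν j else lam l)
    (Equiv.swap i k, fun l => if l = i ∨ l = k then ν k else lam l) hD hC
    (term_ne_of_fst_ne n1'') (term_ne_of_fst_ne (by rw [transposeTerm_fst]; simpa using n1'')) hH₁
    (term_ne_of_fst_ne n2) (term_ne_of_fst_ne (by rw [transposeTerm_fst]; exact n2')) hH₂
    (term_ne_of_fst_ne n3) (term_ne_of_fst_ne (by rw [transposeTerm_fst]; exact n3')) hH₃ ?_ ?_
  · simp only [sum_three hij hki hkj] at h
    simp [hij, hki, hkj, hij.symm] at h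
    linarith
  · simp only [sum_three hij hki hkj]
    simp [hij, hki, hkj, hjk, hik, hij.symm]
    ring
  · simp only [sum_three hij hki hkj]
    simp [hij, hki, hkj, hjk, hik, hij.symm, hσi, hσj, hσk,
      Equiv.swap_apply_left, Equiv.swap_apply_right, Equiv.swap_apply_of_ne_of_ne]
    linarith [hv i j (ν i), hv j k (ν j), hv i k (ν k)]


/-- **Rule R3′w** (`C(c) = (σ, ν)` orbit-dominant at `θ₁`, `D(λ)` at `θ₂ > θ₁`; same three hybrids present): `2·d(ν i) < d(λ i) + d(λ j)`.
[folklore; method memo §3 R3′w] -/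
theorem rule_R3w' (d : Fin K → ℕ) (v ε : Fin 3 → Fin 3 → Fin K → ℤ) (hv : ∀ a b l, v a b l = v b a l)
    {θ₁ θ₂ : ℤ} (hθ : θ₁ < θ₂) (lam ν : Fin 3 → Fin K)
    (hC : IsOrbitDominant d v ε θ₁ (σ, ν)) (hD : IsOrbitDominant d v ε θ₂ (1, lam))
    (hH₁ : termSign ε (Equiv.swap i j, fun l => if l = i ∨ l = j then ν i else lam l) ≠ 0)
    (hH₂ : termSign ε (Equiv.swap j k, fun l => if l = j ∨ l = k then ν j else lam l) ≠ 0)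
    (hH₃ : termSign ε (Equiv.swap i k, fun l => if l = i ∨ l = k then ν k else lam l) ≠ 0) :
    2 * (d (ν i) : ℤ) < d (lam i) + d (lam j) := by
  obtain ⟨n1, n1', n1''⟩ := swap_ij_ne_cycle hij hki hkj σ hσi hσj hσk
  obtain ⟨n2, n2'⟩ := swap_jk_ne_cycle hij hki σ hσi hσj hσk
  obtain ⟨n3, n3'⟩ := swap_ik_ne_cycle hij hkj σ hσi hσj hσk
  have hjk : j ≠ k := fun h => hkj h.symm
  have hik : i ≠ k := fun h => hki h.symm
  have h := orbit_exchange₂' d v ε hθ (1, lam) (σ, ν)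
    (Equiv.swap i j, fun l => if l = i ∨ l = j then ν i else lam l)
    (Equiv.swap j k, fun l => if l = j ∨ l = k then ν j else lam l)
    (Equiv.swap i k, fun l => if l = i ∨ l = k then ν k else lam l) hC hD
    (term_ne_of_fst_ne n1'') (term_ne_of_fst_ne (by rw [transposeTerm_fst]; simpa using n1'')) hH₁
    (term_ne_of_fst_ne n2) (term_ne_of_fst_ne (by rw [transposeTerm_fst]; exact n2')) hH₂
    (term_ne_of_fst_ne n3) (term_ne_of_fst_ne (by rw [transposeTerm_fst]; exact n3')) hH₃ ?_ ?_
  · simp only [sum_three hij hki hkj] at h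
    simp [hij, hki, hkj, hij.symm] at h
    linarith
  · simp only [sum_three hij hki hkj]
    simp [hij, hki, hkj, hjk, hik, hij.symm]
    ring
  · simp only [sum_three hij hki hkj]
    simp [hij, hki, hkj, hjk, hik, hij.symm, hσi, hσj, hσk,
      Equiv.swap_apply_left, Equiv.swap_apply_right, Equiv.swap_apply_of_ne_of_ne]
    linarith [hv i j (ν i), hv j k (ν j), hv i k (ν k)]

/-! ## Rule R2w / R2′w: a transposition orbit against the pair orbit -/

/-- **Rule R2w** (`T_{ij}(b|a) = (swap i j, [i, j ↦ b; k ↦ a])` orbit-dominant at `θ₁`, `C(c) = (σ, ν)` orbit-dominant at `θ₂ > θ₁`;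
the hybrids `C(c; {i,j} ↦ b) = (σ, [i ↦ b; l ↦ ν l])` and `T_{ij}(ν i|a)` present): `d a + d b < d(ν j) + d(ν k)` — the two pairs NOT
read by `T`.  One comparison is weak (`C` against `C(c; {i,j} ↦ b)`, which IS `C` when `b = ν i`). [folklore; method memo §3 R2w] -/
theorem rule_R2w (d : Fin K → ℕ) (v ε : Fin 3 → Fin 3 → Fin K → ℤ) (hv : ∀ a b l, v a b l = v b a l)
    {θ₁ θ₂ : ℤ} (hθ : θ₁ < θ₂) (a b : Fin K) (ν : Fin 3 → Fin K)
    (hT : IsOrbitDominant d v ε θ₁ (Equiv.swap i j, fun l => if l = i ∨ l = j then b else a))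
    (hC : IsOrbitDominant d v ε θ₂ (σ, ν))
    (hC' : termSign ε (σ, fun l => if l = i then b else ν l) ≠ 0)
    (hH₃ : termSign ε (Equiv.swap i j, fun l => if l = i ∨ l = j then ν i else a) ≠ 0) :
    (d a : ℤ) + d b < d (ν j) + d (ν k) := by
  obtain ⟨n1, n1', -⟩ := swap_ij_ne_cycle hij hki hkj σ hσi hσj hσk
  have hjk : j ≠ k := fun h => hkj h.symm
  have hik : i ≠ k := fun h => hki h.symm
  have h := orbit_exchange₂_le d v ε hv hθ
    (Equiv.swap i j, fun l => if l = i ∨ l = j then b else a) (σ, ν)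
    (σ, fun l => if l = i then b else ν l) (σ, fun l => if l = i then b else ν l)
    (Equiv.swap i j, fun l => if l = i ∨ l = j then ν i else a) hT hC
    (term_ne_of_fst_ne n1.symm) (term_ne_of_fst_ne (by rw [transposeTerm_fst]; simpa using n1.symm)) hC' hC'
    (term_ne_of_fst_ne n1) (term_ne_of_fst_ne (by rw [transposeTerm_fst]; exact n1')) hH₃ ?_ ?_
  · simp only [sum_three hij hki hkj] at h
    simp [hij, hki, hkj, hij.symm] at h
    linarith
  · simp only [sum_three hij hki hkj]
    simp [hij, hki, hkj, hij.symm]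
    ring
  · simp only [sum_three hij hki hkj]
    simp [hij, hki, hkj, hij.symm, hσi, hσj, hσk,
      Equiv.swap_apply_left, Equiv.swap_apply_right, Equiv.swap_apply_of_ne_of_ne]
    linarith [hv i j (ν i), hv i j b]

/-- **Rule R2′w** (`C(c) = (σ, ν)` orbit-dominant at `θ₁`, `T_{ij}(b|a)` orbit-dominant at `θ₂ > θ₁`; same two hybrids present):
`d(ν j) + d(ν k) < d a + d b`. [folklore; method memo §3 R2′w] -/
theorem rule_R2w' (d : Fin K → ℕ) (v ε : Fin 3 → Fin 3 → Fin K → ℤ) (hv : ∀ a b l, v a b l = v b a l)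
    {θ₁ θ₂ : ℤ} (hθ : θ₁ < θ₂) (a b : Fin K) (ν : Fin 3 → Fin K)
    (hC : IsOrbitDominant d v ε θ₁ (σ, ν))
    (hT : IsOrbitDominant d v ε θ₂ (Equiv.swap i j, fun l => if l = i ∨ l = j then b else a))
    (hC' : termSign ε (σ, fun l => if l = i then b else ν l) ≠ 0)
    (hH₃ : termSign ε (Equiv.swap i j, fun l => if l = i ∨ l = j then ν i else a) ≠ 0) :
    (d (ν j) : ℤ) + d (ν k) < d a + d b := by
  obtain ⟨n1, n1', -⟩ := swap_ij_ne_cycle hij hki hkj σ hσi hσj hσk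
  have hjk : j ≠ k := fun h => hkj h.symm
  have hik : i ≠ k := fun h => hki h.symm
  have h := orbit_exchange₂'_le d v ε hv hθ
    (Equiv.swap i j, fun l => if l = i ∨ l = j then b else a) (σ, ν)
    (σ, fun l => if l = i then b else ν l) (σ, fun l => if l = i then b else ν l)
    (Equiv.swap i j, fun l => if l = i ∨ l = j then ν i else a) hC hT
    (term_ne_of_fst_ne n1.symm) (term_ne_of_fst_ne (by rw [transposeTerm_fst]; simpa using n1.symm)) hC' hC'
    (term_ne_of_fst_ne n1) (term_ne_of_fst_ne (by rw [transposeTerm_fst]; exact n1')) hH₃ ?_ ?_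
  · simp only [sum_three hij hki hkj] at h
    simp [hij, hki, hkj, hij.symm] at h
    linarith
  · simp only [sum_three hij hki hkj]
    simp [hij, hki, hkj, hij.symm]
    ring
  · simp only [sum_three hij hki hkj]
    simp [hij, hki, hkj, hij.symm, hσi, hσj, hσk,
      Equiv.swap_apply_left, Equiv.swap_apply_right, Equiv.swap_apply_of_ne_of_ne]
    linarith [hv i j (ν i), hv i j b]

/-! ## Rule P for the pair carrier: the sign of a 3-cycle term -/

omit hσi hσj hσk in
/-- every index of `Fin 3` is one of `i, j, k`. -/
theorem eq_or_eq_or_eq_three (x : Fin 3) : x = i ∨ x = j ∨ x = k := by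
  by_cases hxi : x = i
  · exact Or.inl hxi
  by_cases hxj : x = j
  · exact Or.inr (Or.inl hxj)
  have hx : x ∈ (Finset.univ.erase i).erase j :=
    Finset.mem_erase.mpr ⟨hxj, Finset.mem_erase.mpr ⟨hxi, Finset.mem_univ x⟩⟩
  rw [univ_erase_erase_three i j k hij hki hkj, Finset.mem_singleton] at hx
  exact Or.inr (Or.inr hx)

/-- the 3-cycle `i → j → k → i` is the product of two transpositions. -/
theorem cycle_eq_swap_mul_swap : σ = Equiv.swap i k * Equiv.swap i j := by
  have hjk : j ≠ k := fun h => hkj h.symm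
  have hik : i ≠ k := fun h => hki h.symm
  ext x
  rcases eq_or_eq_or_eq_three hij hki hkj x with rfl | rfl | rfl
  · rw [hσi, Equiv.Perm.mul_apply, Equiv.swap_apply_left, Equiv.swap_apply_of_ne_of_ne hij.symm hjk]
  · rw [hσj, Equiv.Perm.mul_apply, Equiv.swap_apply_right, Equiv.swap_apply_left]
  · rw [hσk, Equiv.Perm.mul_apply, Equiv.swap_apply_of_ne_of_ne hki hkj, Equiv.swap_apply_right]

/-- a 3-cycle is even. -/
theorem sign_cycle_three : Equiv.Perm.sign σ = 1 := by
  have hik : i ≠ k := fun h => hki h.symm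
  rw [cycle_eq_swap_mul_swap hij hki hkj σ hσi hσj hσk, Equiv.Perm.sign_mul, Equiv.Perm.sign_swap hik,
    Equiv.Perm.sign_swap hij]
  simp

omit hσi hσj hσk in
/-- a product over `Fin 3` written at a labelling `{i, j, k} = Fin 3`. [folklore] -/
theorem prod_three (F : Fin 3 → ℤ) : ∏ l, F l = F i * F j * F k := by
  rw [← Finset.mul_prod_erase _ _ (Finset.mem_univ i),
    ← Finset.mul_prod_erase _ _ (Finset.mem_erase.mpr ⟨hij.symm, Finset.mem_univ j⟩),
    univ_erase_erase_three i j k hij hki hkj, Finset.prod_singleton]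
  ring

/-- **Rule P for the pair carrier**: the sign of the 3-cycle term `(σ, ν)` is the product of its three off-diagonal letter signs
`ε_{ji}(ν i)·ε_{kj}(ν j)·ε_{ik}(ν k)` (the permutation is even); both members of the orbit have this sign (`termSign_transpose`).
[folklore; method memo §3 P] -/
theorem termSign_cycle_three (ε : Fin 3 → Fin 3 → Fin K → ℤ) (ν : Fin 3 → Fin K) :
    termSign ε (σ, ν) = ε j i (ν i) * ε k j (ν j) * ε i k (ν k) := by
  unfold termSign
  simp only
  rw [sign_cycle_three hij hki hkj σ hσi hσj hσk, prod_three hij hki hkj, hσi, hσj, hσk]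
  simp

end ThreeCycle

end Summit.ValiantsHypothesis.ValiantsHypothesis.Theorems.LacunarySymmetroidMatrixDescartes.TropicalCensus.Orbit
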